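import Summits.CriticalPhenomena.PercolationContinuityZ3.Theorems.PercNearOneGluingNoHeavyLowerTailBlockQ9DynReduction
import Summits.CriticalPhenomena.PercolationContinuityZ3.Theorems.PercNearOneGluingNoHeavyLowerTailRelaxedPreFKG
import HarnessLib

/-!
# `NoHeavyLowerTail` (stmt-CriticalPhenomena-4575) — the dynamic-anchor line closes the crux CONDITIONALLY on its one-step local statement

Support file (lemma factory `prim-lf-1` gen 9; `--supports stmt-CriticalPhenomena-4575`).  No definitions, no named facts, no sorries.

`noHeavyLowerTail_of_localStep`: if the local step `BlockQ9.LocalStep A b` (memo FROM-prim-lf-1-gen9.md §6 (B2); HOME/EC-NOTE.md §13;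
this unit's conjecture DQ9, 0 violations in 1.7 M censused states) holds for every relay set `A` and target `b ∈ A` on every `Fin n`, then the
crux `NoHeavyLowerTail` holds.  Chain: `q9_of_localStep` (Question 9 for the `(G − o)`-minimiser) ⇒ Kozma–Nitzan's (41) for some anchor ⇒
the relaxed pre-FKG inequality with constant `1` ⇒ `noHeavyLowerTail_of_relaxedPreFKG`.
[cite: KozmaNitzan2024, Conjecture 2 (p. 3), Question 9 (p. 36)]
-/

noncomputable section

namespace Summit.CriticalPhenomena.PercolationContinuityZ3.Theorems

open MeasureTheory Set Literature.Probability.LatticeModels Literature.Probability.Percolation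
open scoped Classical BigOperators

/-- **Conditional closing of the crux by the dynamic-anchor line**: the one-step local statement at every block state (for every
`n`, `A`, `b ∈ A`) implies `NoHeavyLowerTail`. [cite: KozmaNitzan2024, Conjecture 2 (p. 3), Question 9 (p. 36)] -/
theorem noHeavyLowerTail_of_localStep
    (hstep : ∀ (n : ℕ) (A : Finset (Fin n)) (b : Fin n), b ∈ A → BlockQ9.LocalStep A b) :
    Summit.CriticalPhenomena.PercolationContinuityZ3.Theses.PercNearOneGluingNoHeavy.NoHeavyLowerTail := by
  refine noHeavyLowerTail_of_relaxedPreFKG 1 zero_le_one fun n w A o b hoA hbA => ?_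
  have hmeas : ∀ s : Set (BondConfig (Fin n)), MeasurableSet s := fun _ => MeasurableSet.of_discrete
  set U : Set (BondConfig (Fin n)) := ⋃ x ∈ A, (openConn o x : Set (BondConfig (Fin n))) with hU
  by_cases hex : ∃ a ∈ A, a ≠ b
  · -- a (G − o)-minimiser among the relays other than `b`
    have hne : (A.filter fun a => a ≠ b).Nonempty := by
      obtain ⟨a, ha, hab⟩ := hex; exact ⟨a, Finset.mem_filter.2 ⟨ha, hab⟩⟩
    obtain ⟨a, haF, hmin⟩ := (A.filter fun a => a ≠ b).exists_min_image
      (fun a => (prodBernoulli (fun e : Sym2 (Fin n) => if (∃ x ∈ e, x ∈ ({o} : Finset (Fin n))) then 0 else w e)).real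
        (openConn a b)) hne
    obtain ⟨haA, hab⟩ := Finset.mem_filter.1 haF
    have hK : BlockQ9.IsKMin A b w {o} a :=
      ⟨haA, hab, fun a' ha' hne' => hmin a' (Finset.mem_filter.2 ⟨ha', hne'⟩)⟩
    have h41 := BlockQ9.q9_of_localStep A b hbA (hstep n A b hbA) w o a hoA hK
    refine ⟨a, haA, ?_⟩
    -- μ(U) − μ(o ↔ b) ≤ μ(U) − μ(a ↔ b ∩ U) = μ((a ↔ b)ᶜ ∩ U)
    have hsplit : (prodBernoulli w).real U =
        (prodBernoulli w).real (U ∩ openConn a b) + (prodBernoulli w).real (U \ openConn a b) :=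
      (measureReal_inter_add_sdiff (s := U) (hmeas (openConn a b)) (h := measure_ne_top _ _)).symm
    have h1 : (prodBernoulli w).real (U ∩ openConn a b) = (prodBernoulli w).real (openConn a b ∩ U) := by rw [inter_comm]
    have h2 : (U \ openConn a b : Set (BondConfig (Fin n))) = (openConn a b)ᶜ ∩ U := by
      ext ω; simp only [mem_sdiff, mem_inter_iff, mem_compl_iff]; tauto
    rw [one_mul, ← h2]
    linarith
  · -- every relay is `b`: `U ⊆ {o ↔ b}`
    push Not at hex
    refine ⟨b, hbA, ?_⟩
    have hUb : U ⊆ openConn o b := by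
      intro ω hω
      obtain ⟨x, hx, hωx⟩ := mem_iUnion₂.1 hω
      rwa [hex x hx] at hωx
    have h0 : 0 ≤ 1 * (prodBernoulli w).real ((openConn b b : Set (BondConfig (Fin n)))ᶜ ∩ U) := by
      have := (measureReal_nonneg : 0 ≤ (prodBernoulli w).real ((openConn b b : Set (BondConfig (Fin n)))ᶜ ∩ U)); linarith
    linarith [measureReal_mono (μ := prodBernoulli w) hUb]

end Summit.CriticalPhenomena.PercolationContinuityZ3.Theorems

end
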